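import Summits.HodgeConjecture.HodgeConjecture.Theorems.GenericDivisibilityGenericDivisibilityBoundedHeartDescent
import Literature.AlgebraicGeometry.HodgeTheory.SurjectivePullbackAlgebraicClasses
import Literature.Geometry.Manifold.DeRhamFundamentalClassPairing
import HarnessLib

/-!
# The degree of a surjective morphism of smooth projective complex `n`-folds is a non-zero
# integer (line `finite-level-bootstrap`, crux C2 `GenericDivisibilityBounded`,
# stmt-HodgeConjecture-18467)

Registered sub-goal `stub_hasDegreeNeZeroOfSurjective` (lead c6, wave 2). Sorry-free,
definition-free. `X'`, `X` are smooth projective over `ℂ` of the same dimension `n`, `f : X' ⟶ X` a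
`ℂ`-morphism which is onto on points, `f(ℂ) = AlgPoints.mapContinuous f : X'(ℂ) → X(ℂ)`, and `μ`,
`ν` ARBITRARY integral orientations of the closed connected `2n`-manifolds `X'(ℂ)`, `X(ℂ)`
(`HomologicalOrientation ℤ`). We prove `∃ d : ℤ, d ≠ 0 ∧ f(ℂ)_* [X'(ℂ)]_μ = d • [X(ℂ)]_ν`
(`HasDegree μ ν f(ℂ) d`), removing the degree datum from the descent of the line's heart along
surjections (`…HeartOfHasDegree`, `…HeartDescent`).

## Proof

* EXISTENCE of `d` (Hatcher Thm. 3.26(a)): `H_{2n}(X(ℂ);ℤ) = ℤ · [X(ℂ)]_ν` on the closed connected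
  `ℤ`-oriented manifold `X(ℂ)` (`exists_eq_smul_fundamentalClass_of_connectedSpace`), so
  `f(ℂ)_* [X'(ℂ)]_μ = d • [X(ℂ)]_ν` for some `d ∈ ℤ`.
* `d ≠ 0` (Voisin I Lemma 7.28 / Remark 7.29): change coefficients along `ℤ → ℂ`. The
  push-forward `f(ℂ)_* : H_{2n}(X'(ℂ);ℂ) → H_{2n}(X(ℂ);ℂ)` is ONTO, because
  `f^* : H^{2n}(X(ℂ);ℂ) → H^{2n}(X'(ℂ);ℂ)` is one-to-one for `f` surjective between smooth projective
  varieties of the same dimension (`complexBetti_map_injective_of_surjective_of_dim_eq`) and over a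
  field one-to-one on `Hⁿ` gives onto on `Hₙ` (`surjective_homologyMap_of_injective_cohomologyMap`,
  Hatcher Thm. 3.2). If `d = 0` then `f(ℂ)_* [X'(ℂ)]_μ = 0`, hence `f(ℂ)_* ([X'(ℂ)]_μ ⊗ 1) = 0`
  (`singularHomology.coeffChange_map`); every class of `H_{2n}(X'(ℂ);ℂ)` is a multiple of
  `[X'(ℂ)]_μ ⊗ 1` (`exists_eq_smul_coeffChange_fundamentalClass`), so `f(ℂ)_* = 0` on
  `H_{2n}(–;ℂ)`; being onto, `H_{2n}(X(ℂ);ℂ) = 0`, contradicting `[X(ℂ)]_ν ⊗ 1 ≠ 0`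
  (`coeffChange_fundamentalClass_ne_zero`).

## Main results

* `genericDivisibilityBounded_exists_hasDegree` — existence of the integral degree `d` of any
  continuous map into `X(ℂ)` from a closed oriented manifold, read on `f(ℂ)`.
* `genericDivisibilityBounded_hasDegree_ne_zero_of_surjective` — a degree of a surjection of smooth
  projective `n`-folds is `≠ 0`.
* `genericDivisibilityBounded_exists_hasDegree_ne_zero_of_surjective` — both together.
* `stub_hasDegreeNeZeroOfSurjective` — the registered signature, verbatim.

References: [HatcherAT2002] §3.3 Thm. 3.26, §3.1 Thm. 3.2 and p. 198; [VoisinHodgeI2002] §7.3.2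
Lemma 7.28, Remark 7.29; [FultonYoungTableaux1997] App. B §B.1 (7).
-/

set_option linter.dupNamespace false

noncomputable section

namespace Summit.HodgeConjecture.HodgeConjecture.Theorems

open CategoryTheory AlgebraicGeometry
open Literature.AlgebraicGeometry.Motives Literature.AlgebraicGeometry.HodgeTheory
  Literature.AlgebraicTopology.SingularHomology

/-! ### Existence of the integral degree -/

/-- **Every `ℂ`-morphism `f : X' ⟶ X` of smooth projective `n`-folds has an integral degree** for
any integral orientations `μ`, `ν` of `X'(ℂ)`, `X(ℂ)`: `f(ℂ)_* [X'(ℂ)]_μ = d • [X(ℂ)]_ν` for some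
`d ∈ ℤ`, because `H_{2n}(X(ℂ);ℤ) = ℤ · [X(ℂ)]_ν` on the closed connected oriented `2n`-manifold
`X(ℂ)` (Hatcher Thm. 3.26(a); the tree's `exists_eq_smul_fundamentalClass_of_connectedSpace`; the
module scalar multiplication of `H_{2n}(X(ℂ);ℤ) ∈ ModuleCat ℤ` and the multiple `d • –` agree,
`int_smul_eq_zsmul`). [cite: HatcherAT2002, §3.3 Thm. 3.26]
[cite: VoisinHodgeI2002, §7.3.2 Lemma 7.28] -/
theorem genericDivisibilityBounded_exists_hasDegree {n : ℕ} {X' X : SchemeOver ℂ} (f : X' ⟶ X)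
    (hX : IsSmoothProjective n X) (μ : HomologicalOrientation ℤ (ComplexPoints X') (2 * n))
    (ν : HomologicalOrientation ℤ (ComplexPoints X) (2 * n)) :
    ∃ d : ℤ, HasDegree μ ν (AlgPoints.mapContinuous (L := ℂ) f) d := by
  letI := hX.chartedSpace
  haveI := ComplexPoints.compactSpace_of_isSmoothProjective hX
  haveI := ComplexPoints.t2Space_of_isSmoothProjective hX
  haveI := connectedSpace_complexPoints hX
  obtain ⟨d, hd⟩ := exists_eq_smul_fundamentalClass_of_connectedSpace ν
    (singularHomology.map ℤ ℤ (AlgPoints.mapContinuous (L := ℂ) f) (2 * n) μ.fundamentalClass)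
  refine ⟨d, ?_⟩
  rw [HasDegree, hd]
  exact int_smul_eq_zsmul _ d _

/-! ### The degree of a surjection is non-zero -/

/-- **A degree of a surjective morphism of smooth projective `n`-folds is non-zero** (Voisin I
Lemma 7.28 / Remark 7.29, for arbitrary integral orientations `μ`, `ν`). If
`f(ℂ)_* [X'(ℂ)]_μ = d • [X(ℂ)]_ν` with `f` onto on points then `d ≠ 0`: over `ℂ`,
`f(ℂ)_* : H_{2n}(X'(ℂ);ℂ) → H_{2n}(X(ℂ);ℂ)` is onto (`f^*` is one-to-one on `H^{2n}(–;ℂ)`,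
`complexBetti_map_injective_of_surjective_of_dim_eq`, and Hatcher Thm. 3.2,
`surjective_homologyMap_of_injective_cohomologyMap`); if `d = 0` then `f(ℂ)_*` kills
`[X'(ℂ)]_μ ⊗ 1` (`singularHomology.coeffChange_map`), which spans the line `H_{2n}(X'(ℂ);ℂ)`
(`exists_eq_smul_coeffChange_fundamentalClass`), so `f(ℂ)_* = 0` and `H_{2n}(X(ℂ);ℂ) = 0`,
contradicting `[X(ℂ)]_ν ⊗ 1 ≠ 0` (`coeffChange_fundamentalClass_ne_zero`).
[cite: VoisinHodgeI2002, §7.3.2 Lemma 7.28] [cite: HatcherAT2002, §3.3 Thm. 3.26] -/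
theorem genericDivisibilityBounded_hasDegree_ne_zero_of_surjective {n : ℕ} {X' X : SchemeOver ℂ}
    (f : X' ⟶ X) (hX' : IsSmoothProjective n X') (hX : IsSmoothProjective n X)
    (μ : HomologicalOrientation ℤ (ComplexPoints X') (2 * n))
    (ν : HomologicalOrientation ℤ (ComplexPoints X) (2 * n)) (hf : Function.Surjective f.left.base)
    {d : ℤ} (hdeg : HasDegree μ ν (AlgPoints.mapContinuous (L := ℂ) f) d) : d ≠ 0 := by
  letI := hX'.chartedSpace
  letI := hX.chartedSpace
  haveI := ComplexPoints.compactSpace_of_isSmoothProjective hX'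
  haveI := ComplexPoints.t2Space_of_isSmoothProjective hX'
  haveI := ComplexPoints.compactSpace_of_isSmoothProjective hX
  haveI := ComplexPoints.t2Space_of_isSmoothProjective hX
  haveI := connectedSpace_complexPoints hX'
  haveI := connectedSpace_complexPoints hX
  haveI : AlgebraicGeometry.Surjective f.left := ⟨hf⟩
  rintro rfl
  rw [HasDegree, zero_zsmul] at hdeg
  -- `f(ℂ)_*` is onto on `H_{2n}(–;ℂ)` (Voisin I Lemma 7.28, transposed)
  have hs : Function.Surjective
      (singularHomology.map ℂ ℂ (AlgPoints.mapContinuous (L := ℂ) f) (2 * n)) :=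
    surjective_homologyMap_of_injective_cohomologyMap ℂ (AlgPoints.mapContinuous (L := ℂ) f) (2 * n)
      (complexBetti_map_injective_of_surjective_of_dim_eq hX' hX f (2 * n))
  -- `f(ℂ)_* = 0` on `H_{2n}(X'(ℂ);ℂ) = ℂ · ([X'(ℂ)]_μ ⊗ 1)`
  have h0 : ∀ z : singularHomology ℂ ℂ (ComplexPoints X') (2 * n),
      singularHomology.map ℂ ℂ (AlgPoints.mapContinuous (L := ℂ) f) (2 * n) z = 0 := by
    intro z
    obtain ⟨r, rfl⟩ :=
      Literature.Geometry.Manifold.exists_eq_smul_coeffChange_fundamentalClass ℂ μ z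
    rw [map_smul, ← singularHomology.coeffChange_map, hdeg, map_zero, smul_zero]
  -- but `[X(ℂ)]_ν ⊗ 1 ≠ 0` lies in the image
  refine Literature.Geometry.Manifold.coeffChange_fundamentalClass_ne_zero ℂ ν ?_
  obtain ⟨z, hz⟩ := hs (singularHomology.coeffChange (ComplexPoints X)
    (algebraMap ℤ ℂ : ℤ →+* ℂ).toAddMonoidHom (2 * n) ν.fundamentalClass)
  rw [← hz, h0]

/-- **The degree of a surjective morphism of smooth projective complex `n`-folds is a non-zero
integer**, for any integral orientations `μ`, `ν` of `X'(ℂ)`, `X(ℂ)`: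
`∃ d ≠ 0, f(ℂ)_* [X'(ℂ)]_μ = d • [X(ℂ)]_ν` (`genericDivisibilityBounded_exists_hasDegree` and
`genericDivisibilityBounded_hasDegree_ne_zero_of_surjective`). [cite: HatcherAT2002, §3.3 Thm. 3.26]
[cite: VoisinHodgeI2002, §7.3.2 Lemma 7.28] -/
theorem genericDivisibilityBounded_exists_hasDegree_ne_zero_of_surjective {n : ℕ}
    {X' X : SchemeOver ℂ} (f : X' ⟶ X) (hX' : IsSmoothProjective n X') (hX : IsSmoothProjective n X)
    (μ : HomologicalOrientation ℤ (ComplexPoints X') (2 * n))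
    (ν : HomologicalOrientation ℤ (ComplexPoints X) (2 * n)) (hf : Function.Surjective f.left.base) :
    ∃ d : ℤ, d ≠ 0 ∧ HasDegree μ ν (AlgPoints.mapContinuous (L := ℂ) f) d := by
  obtain ⟨d, hd⟩ := genericDivisibilityBounded_exists_hasDegree f hX μ ν
  exact ⟨d, genericDivisibilityBounded_hasDegree_ne_zero_of_surjective f hX' hX μ ν hf hd, hd⟩

/-! ### The registered sub-goal -/

/-- **Registered sub-goal `stub_hasDegreeNeZeroOfSurjective` of stmt-HodgeConjecture-18467 (lead
c6, wave 2, line `finite-level-bootstrap`): the degree of a surjective morphism of smooth projective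
`n`-folds is a non-zero integer, for any integral orientations.** For `f : X' ⟶ X` a `ℂ`-morphism of
smooth projective `n`-folds which is onto on points and integral orientations `μ`, `ν` of `X'(ℂ)`,
`X(ℂ)`: `∃ d : ℤ, d ≠ 0 ∧ f(ℂ)_* [X'(ℂ)]_μ = d • [X(ℂ)]_ν` (Hatcher Thm. 3.26(a) for the existence
of `d`; Voisin I Lemma 7.28 transposed — `f(ℂ)_*` onto on `H_{2n}(–;ℂ)` — and
`[X'(ℂ)]_μ ⊗ 1 ≠ 0`, `[X(ℂ)]_ν ⊗ 1 ≠ 0` for `d ≠ 0`). Statement: the skeleton's, verbatim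
(`AlgPoints.mapContinuous f` elaborates with `L := ℂ`, forced by `μ`, `ν`).
[cite: HatcherAT2002, §3.3 Thm. 3.26] [cite: VoisinHodgeI2002, §7.3.2 Lemma 7.28] -/
theorem stub_hasDegreeNeZeroOfSurjective :
    ∀ ⦃n : ℕ⦄ ⦃X' X : SchemeOver ℂ⦄ (f : X' ⟶ X)
      (μ : HomologicalOrientation ℤ (ComplexPoints X') (2 * n))
      (ν : HomologicalOrientation ℤ (ComplexPoints X) (2 * n)),
      IsSmoothProjective n X' → IsSmoothProjective n X → Function.Surjective f.left.base →
      ∃ d : ℤ, d ≠ 0 ∧ HasDegree μ ν (AlgPoints.mapContinuous f) d :=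
  fun _ _ _ f μ ν hX' hX hf ↦
    genericDivisibilityBounded_exists_hasDegree_ne_zero_of_surjective f hX' hX μ ν hf

end Summit.HodgeConjecture.HodgeConjecture.Theorems

end
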